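import Summits.CriticalPhenomena.SAWScalingLimit.Theorems.SAWDevelopingMapObservableToSLETypeLadderCarvedReductionSqueezeBulkHull
import HarnessLib

/-!
# The COMPONENT-KERNEL hypothesis of the frame from the frontier of the bulk
# (piece (T-A′₂ kernel) of stub T-A′₂ `stub_carvedReduction_squeezeGeometry_domainsCore`)

Crux `SAWDevelopingMap.ObservableToSLE` (stmt-CriticalPhenomena-10472), line `six-class-type-ladder`,
stub T-A′₂ `stub_carvedReduction_squeezeGeometry_domainsCore`.  Landing target:
`Summits/CriticalPhenomena/SAWScalingLimit/Theorems/SAWDevelopingMapObservableToSLETypeLadderCarvedReductionSqueezeKernelFrontier.lean`.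

The frame `Squeeze.stub_carvedReduction_derivFrame` (p129409) asks, of the outer approximants
`E_n` of the bulk `Ω` (hull `A`, `ℍ ∖ A = φ⁻¹Ω`), the COMPONENT-KERNEL property: every open
preconnected `W ⊆ ⋂ n, ℍ ∖ φ.pullbackHull E_n` meeting `ℍ ∖ A` lies in `ℍ ∖ A`.
`kernel_of_frontier` reduces it to a statement about the plane: every point of
`frontier Ω ∩ E` is a limit of points eventually SWALLOWED by the approximants
(`frontier Ω ∩ E ⊆ closure {w | ∃ n, w ∉ E_n}`).  Proof: `φ(W)` is open, preconnected, meets `Ω`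
and, if `W ⊄ ℍ ∖ A`, also `E ∖ Ω`, hence meets `frontier Ω` (`inter_frontier_nonempty`) at a point
of `E`; a swallowed point inside the neighbourhood `φ(W)` contradicts `φ(W) ⊆ E_n` for all `n`.
(In T-A′₂ the swallowed set contains, for large `n`, every interior point of a nondegenerate limit
hexagon and every point of `E` outside `closure (D - τ)`, and these accumulate at every point of
`frontier Ω ∩ E ⊆ ⋃ Hex ∪ frontier (D - τ)`.)
Registered carrier: `stub_carvedReduction_kernelFrontier`.
-/

noncomputable section

open Set Filter Topology Metric
open UpperHalfPlane (upperHalfPlaneSet isOpen_upperHalfPlaneSet)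
open Literature.Probability.RandomPlanarGeometry

namespace Summit.CriticalPhenomena.SAWScalingLimit.Theorems.ObservableToSLE.TypeLadder

/-- **A preconnected set meeting an open set and its complement meets its frontier.** -/
theorem inter_frontier_nonempty {c O : Set ℂ} (hc : IsPreconnected c) (hO : IsOpen O)
    (h1 : (c ∩ O).Nonempty) (h2 : (c ∩ Oᶜ).Nonempty) : (c ∩ frontier O).Nonempty := by
  by_contra h
  rw [not_nonempty_iff_eq_empty] at h
  have hsub : c ⊆ O ∪ (closure O)ᶜ := by
    intro z hz
    by_cases hz1 : z ∈ closure O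
    · rw [closure_eq_self_union_frontier] at hz1
      rcases hz1 with h' | h'
      · exact Or.inl h'
      · have : z ∈ c ∩ frontier O := ⟨hz, h'⟩
        rw [h] at this
        exact this.elim
    · exact Or.inr hz1
  have hdisj : Disjoint O (closure O)ᶜ := Set.disjoint_left.2 fun z hz hz' => hz' (subset_closure hz)
  rcases hc.subset_or_subset hO isClosed_closure.isOpen_compl hdisj hsub with h' | h'
  · obtain ⟨z, hz, hz'⟩ := h2
    exact hz' (h' hz)
  · obtain ⟨z, hz, hz'⟩ := h1
    exact h' hz (subset_closure hz')

/-- **THE COMPONENT-KERNEL PROPERTY FROM THE FRONTIER OF THE BULK.**  Let `Ω ⊆ E` be open with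
`ℍ ∖ A = φ.symm '' Ω`, and `E_n` subdomains.  If every point of `frontier Ω ∩ E` is a limit of
points outside some `E_n`, then every open preconnected `W ⊆ ⋂ n, ℍ ∖ φ.pullbackHull E_n`
meeting `ℍ ∖ A` lies in `ℍ ∖ A`. -/
theorem kernel_of_frontier (E : DobrushinDomain) (φ : ConformalEquiv upperHalfPlaneSet E.carrier)
    (Ω A : Set ℂ) (En : ℕ → DobrushinDomain) (hΩo : IsOpen Ω) (hΩE : Ω ⊆ E.carrier)
    (hA : upperHalfPlaneSet \ A = φ.symm '' Ω)
    (hfr : frontier Ω ∩ E.carrier ⊆ closure {w : ℂ | ∃ n, w ∉ (En n).carrier}) :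
    ∀ W : Set ℂ, IsOpen W → IsPreconnected W → W ⊆ ⋂ n, upperHalfPlaneSet \ φ.pullbackHull (En n) →
      (W ∩ (upperHalfPlaneSet \ A)).Nonempty → W ⊆ upperHalfPlaneSet \ A := by
  intro W hWo hWp hWsub ⟨w₀, hw₀W, hw₀⟩
  have hWn : ∀ n, W ⊆ φ.pullbackDomain (En n) := fun n z hz => by
    rw [← ConformalEquiv.diff_pullbackHull]; exact mem_iInter.1 (hWsub hz) n
  have hWH : W ⊆ upperHalfPlaneSet := fun z hz => (hWn 0 hz).1
  by_contra hnot
  obtain ⟨w₁, hw₁W, hw₁⟩ := not_subset.1 hnot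
  -- `φ(W)` is open, preconnected, meets `Ω` (at `φ w₀`) and `Ωᶜ` (at `φ w₁`)
  have hcpre : IsPreconnected (φ '' W) := hWp.image _ (φ.continuousOn.mono hWH)
  have hco : IsOpen (φ '' W) := φ.isOpen_image E.isOpen hWo hWH
  have h0 : φ w₀ ∈ Ω := by
    rw [hA] at hw₀; exact (mem_symm_image_iff hΩE (hWH hw₀W)).1 hw₀
  have h1 : φ w₁ ∉ Ω := fun h => hw₁ (by rw [hA]; exact (mem_symm_image_iff hΩE (hWH hw₁W)).2 h)
  obtain ⟨_, ⟨w₂, hw₂W, rfl⟩, hzfr⟩ :=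
    inter_frontier_nonempty hcpre hΩo ⟨φ w₀, ⟨w₀, hw₀W, rfl⟩, h0⟩ ⟨φ w₁, ⟨w₁, hw₁W, rfl⟩, h1⟩
  -- a swallowed point inside the neighbourhood `φ(W)` of this frontier point
  have hzcl := hfr ⟨hzfr, φ.mapsTo (hWH hw₂W)⟩
  rw [mem_closure_iff_nhds] at hzcl
  obtain ⟨w, ⟨w₃, hw₃W, rfl⟩, n, hwn⟩ := hzcl _ (hco.mem_nhds ⟨w₂, hw₂W, rfl⟩)
  exact hwn (hWn n hw₃W).2

/-- **Registered carrier `stub_carvedReduction_kernelFrontier`** (crux item stmt-CriticalPhenomena-10472,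
stub T-A′₂ `stub_carvedReduction_squeezeGeometry_domainsCore`, piece THE KERNEL FROM THE FRONTIER):
a preconnected set meeting an open set and its complement meets its frontier. -/
theorem stub_carvedReduction_kernelFrontier :
    ∀ (c O : Set ℂ), IsPreconnected c → IsOpen O → (c ∩ O).Nonempty → (c ∩ Oᶜ).Nonempty →
      (c ∩ frontier O).Nonempty :=
  fun _ _ hc hO h1 h2 => inter_frontier_nonempty hc hO h1 h2

end Summit.CriticalPhenomena.SAWScalingLimit.Theorems.ObservableToSLE.TypeLadder

end
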